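import Summits.CriticalPhenomena.CardyFormulaZ2.Theorems.CardySusyWardParafermionFamiliesToSLESixHalfCRVertexRelation
import Summits.CriticalPhenomena.CardyFormulaZ2.Theorems.CardyComplexConeParafermionToSLESixFamiliesIicFluxCorners

/-!
# Flux propagation (stub S6 of line `strip-anchored-vertex-normalisation`, crux stmt-CriticalPhenomena-10814), I: geometry

Helper file 1/4 for `stub_fluxPropagationI` (the contour argument): wall coordinates of a straight piece of
wall `LocalHalfPlane D w₀ n r` (normal `nco`, tangential `tco`), the compact convex collars used for the bulk
inputs, doubled lattice coordinates `U, V` of medial vertices, the criterion `interior_of_nbhd` (a medial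
vertex all of whose neighbouring sites are sites of `Ω_δ` inside a convex subset of `Ω` is `IsInteriorMV`),
and the depth lemma `delta_lt_nco_corner` (corner sites of interior vertices have normal coordinate `> δ`;
registered one-line form `stub_flux_cornerDepth`). All elementary. [folklore]
-/

noncomputable section

namespace Summit.CriticalPhenomena.CardyFormulaZ2.Theorems.ParafermionFamiliesToSLESix.StripAnchored

open MeasureTheory Filter Set Metric Complex
open scoped Topology BigOperators ComplexConjugate
open Literature.Probability.LatticeModels
open Literature.Probability.RandomPlanarGeometry (DobrushinDomain)
open Literature.Barriers.CriticalPhenomena (medialCornersAt medialVertexOf isCorner_medialCornersAt)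
open Literature.Barriers.CriticalPhenomena.HalfCRGreen (twin)
open Summit.CriticalPhenomena.CardyFormulaZ2.Cruxes.ParafermionToSLESixFamilies.IicTraceFluxPairing (medialCornersAt_fst_eq_or
  isCorner_edge_medialCornersAt)

namespace S6

/-! ## Wall coordinates -/

/-- The NORMAL coordinate of `z` for the wall point `w₀` and inward unit normal `n`: `Re((z - w₀)·n̄)`. [folklore] -/
def nco (w₀ n z : ℂ) : ℝ := ((z - w₀) * conj n).re

/-- The TANGENTIAL coordinate of `z`: `Re((z - w₀)·conj(i n))`. [folklore] -/
def tco (w₀ n z : ℂ) : ℝ := ((z - w₀) * conj (I * n)).re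

/-- The tangential coordinate is the normal coordinate for the rotated normal `i n`. [folklore] -/
theorem tco_eq_nco (w₀ n z : ℂ) : tco w₀ n z = nco w₀ (I * n) z := rfl

/-- The tangential coordinate is the imaginary part of `(z - w₀)·n̄`. [folklore] -/
theorem tco_eq_im (w₀ n z : ℂ) : tco w₀ n z = ((z - w₀) * conj n).im := by
  have h : (z - w₀) * conj (I * n) = -I * ((z - w₀) * conj n) := by rw [map_mul, Complex.conj_I]; ring
  rw [tco, h]
  simp [Complex.mul_re]

/-- `wallBox` in wall coordinates. [folklore] -/
theorem mem_wallBox_iff (w₀ n : ℂ) (r h : ℝ) (z : ℂ) : z ∈ wallBox w₀ n r h ↔ |tco w₀ n z| < r ∧ |nco w₀ n z| < h :=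
  Iff.rfl

/-- The rotated normal is a unit vector too. [folklore] -/
theorem norm_I_mul {n : ℂ} (hn : ‖n‖ = 1) : ‖I * n‖ = 1 := by rw [norm_mul, Complex.norm_I, hn, one_mul]

/-- Reconstruction of `z - w₀` from the two wall coordinates: `z - w₀ = n · (nco + i·tco)`. [folklore] -/
theorem sub_eq_normal_mul {n : ℂ} (hn : ‖n‖ = 1) (w₀ z : ℂ) :
    z - w₀ = n * ((nco w₀ n z : ℂ) + (tco w₀ n z : ℂ) * I) := by
  have h1 : ((nco w₀ n z : ℂ) + (tco w₀ n z : ℂ) * I) = (z - w₀) * conj n := by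
    rw [tco_eq_im, nco]; exact Complex.re_add_im _
  have hnn : n * conj n = 1 := by rw [Complex.mul_conj, Complex.normSq_eq_norm_sq, hn]; simp
  calc z - w₀ = (z - w₀) * (n * conj n) := by rw [hnn, mul_one]
    _ = _ := by rw [h1]; ring

/-- Differences of normal coordinates. [folklore] -/
theorem nco_sub (w₀ n z z' : ℂ) : nco w₀ n z - nco w₀ n z' = ((z - z') * conj n).re := by
  simp only [nco, ← Complex.sub_re]
  congr 1; ring

/-- The normal coordinate is `1`-Lipschitz. [folklore] -/
theorem abs_nco_sub_le {n : ℂ} (hn : ‖n‖ = 1) (w₀ z z' : ℂ) : |nco w₀ n z - nco w₀ n z'| ≤ ‖z - z'‖ := by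
  rw [nco_sub]
  refine (Complex.abs_re_le_norm _).trans ?_
  rw [norm_mul, Complex.norm_conj, hn, mul_one]

/-- The tangential coordinate is `1`-Lipschitz. [folklore] -/
theorem abs_tco_sub_le {n : ℂ} (hn : ‖n‖ = 1) (w₀ z z' : ℂ) : |tco w₀ n z - tco w₀ n z'| ≤ ‖z - z'‖ := by
  rw [tco_eq_nco, tco_eq_nco]; exact abs_nco_sub_le (norm_I_mul hn) w₀ z z'

/-- The normal coordinate of the wall point is `0`. [folklore] -/
@[simp] theorem nco_self (w₀ n : ℂ) : nco w₀ n w₀ = 0 := by simp [nco]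

/-- The tangential coordinate of the wall point is `0`. [folklore] -/
@[simp] theorem tco_self (w₀ n : ℂ) : tco w₀ n w₀ = 0 := by simp [tco]

/-- `|nco z| ≤ ‖z - w₀‖`. [folklore] -/
theorem abs_nco_le {n : ℂ} (hn : ‖n‖ = 1) (w₀ z : ℂ) : |nco w₀ n z| ≤ ‖z - w₀‖ := by
  simpa using abs_nco_sub_le hn w₀ z w₀

/-- Distances are controlled by the two coordinate differences. [folklore] -/
theorem norm_sub_le_coords {n : ℂ} (hn : ‖n‖ = 1) (w₀ z z' : ℂ) :
    ‖z - z'‖ ≤ |nco w₀ n z - nco w₀ n z'| + |tco w₀ n z - tco w₀ n z'| := by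
  have h : z - z' = n * (((nco w₀ n z - nco w₀ n z' : ℝ) : ℂ) + ((tco w₀ n z - tco w₀ n z' : ℝ) : ℂ) * I) := by
    rw [show z - z' = (z - w₀) - (z' - w₀) by ring, sub_eq_normal_mul hn w₀ z, sub_eq_normal_mul hn w₀ z']
    push_cast; ring
  rw [h, norm_mul, hn, one_mul]
  exact (Complex.norm_le_abs_re_add_abs_im _).trans (by simp)

/-- In particular `‖z - w₀‖ ≤ |nco z| + |tco z|`. [folklore] -/
theorem norm_sub_le_nco_tco {n : ℂ} (hn : ‖n‖ = 1) (w₀ z : ℂ) : ‖z - w₀‖ ≤ |nco w₀ n z| + |tco w₀ n z| := by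
  simpa using norm_sub_le_coords hn w₀ z w₀

/-- The point `w₀ + n(a + bi)` has wall coordinates `(a, b)`. [folklore] -/
theorem nco_tco_param {n : ℂ} (hn : ‖n‖ = 1) (w₀ : ℂ) (a b : ℝ) :
    nco w₀ n (w₀ + n * ((a : ℂ) + (b : ℂ) * I)) = a ∧ tco w₀ n (w₀ + n * ((a : ℂ) + (b : ℂ) * I)) = b := by
  have hnn : n * conj n = 1 := by rw [Complex.mul_conj, Complex.normSq_eq_norm_sq, hn]; simp
  have h : (w₀ + n * ((a : ℂ) + (b : ℂ) * I) - w₀) * conj n = ((a : ℂ) + (b : ℂ) * I) * (n * conj n) := by ring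
  rw [tco_eq_im, nco, h, hnn, mul_one]
  constructor <;> simp

/-- Normal coordinates of mesh points differ by a lattice-linear amount. [folklore] -/
theorem nco_meshPoint_sub (w₀ n : ℂ) (δ : ℝ) (u v : Site 2) :
    nco w₀ n (meshPoint δ u) - nco w₀ n (meshPoint δ v) =
      δ * (((u 0 - v 0 : ℤ) : ℝ) * n.re + ((u 1 - v 1 : ℤ) : ℝ) * n.im) := by
  rw [nco_sub]
  simp [Complex.mul_re, meshPoint_re, meshPoint_im]
  ring

/-- Distance of two mesh points in terms of lattice coordinates. [folklore] -/
theorem norm_meshPoint_sub_le {δ : ℝ} (hδ : 0 ≤ δ) (u v : Site 2) :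
    ‖meshPoint δ u - meshPoint δ v‖ ≤ δ * (|((u 0 - v 0 : ℤ) : ℝ)| + |((u 1 - v 1 : ℤ) : ℝ)|) := by
  refine (Complex.norm_le_abs_re_add_abs_im _).trans (le_of_eq ?_)
  simp only [Complex.sub_re, Complex.sub_im, meshPoint_re, meshPoint_im]
  push_cast
  rw [← mul_sub, ← mul_sub, abs_mul, abs_mul, abs_of_nonneg hδ]; ring

/-! ## The straight piece of wall and its collars -/

/-- Near `w₀`, membership in the domain is positivity of the normal coordinate. [folklore] -/
theorem mem_carrier_iff {D : DobrushinDomain} {w₀ n : ℂ} {r : ℝ} (hw : LocalHalfPlane D w₀ n r) {z : ℂ}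
    (hz : ‖z - w₀‖ < 4 * r) : z ∈ D.carrier ↔ 0 < nco w₀ n z :=
  hw.2.2 z (by rwa [mem_ball, dist_eq_norm])

/-- The complement of a Dobrushin domain is nonempty (the domain is bounded). [folklore] -/
theorem compl_carrier_nonempty (D : DobrushinDomain) : D.carrierᶜ.Nonempty := by
  by_contra h
  rw [Set.not_nonempty_iff_eq_empty, Set.compl_empty_iff] at h
  exact (NormedSpace.unbounded_univ ℝ ℂ) (h ▸ D.isBounded)

/-- Within `2r` of `w₀`, the depth of a point is at least its normal coordinate. [folklore] -/
theorem nco_le_infDist {D : DobrushinDomain} {w₀ n : ℂ} {r : ℝ} (hw : LocalHalfPlane D w₀ n r) {z : ℂ}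
    (hz : ‖z - w₀‖ < 2 * r) : nco w₀ n z ≤ infDist z D.carrierᶜ := by
  rw [Metric.le_infDist (compl_carrier_nonempty D)]
  intro y hy
  rw [dist_eq_norm]
  by_cases hy4 : ‖y - w₀‖ < 4 * r
  · have hny : ¬ 0 < nco w₀ n y := fun h => hy ((mem_carrier_iff hw hy4).2 h)
    have h1 := abs_nco_sub_le hw.1 w₀ z y
    linarith [le_abs_self (nco w₀ n z - nco w₀ n y), not_lt.1 hny]
  · have h2 : |nco w₀ n z| ≤ ‖z - w₀‖ := abs_nco_le hw.1 w₀ z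
    have h3 : ‖y - w₀‖ ≤ ‖z - w₀‖ + ‖z - y‖ := by
      rw [show y - w₀ = (z - w₀) - (z - y) by ring]; exact norm_sub_le _ _
    linarith [le_abs_self (nco w₀ n z), not_lt.1 hy4]

/-- The compact convex collar `{|tco| ≤ a, b ≤ nco ≤ c}` carrying the bulk inputs. [folklore] -/
def collar (w₀ n : ℂ) (a b c : ℝ) : Set ℂ := {z | |tco w₀ n z| ≤ a ∧ b ≤ nco w₀ n z ∧ nco w₀ n z ≤ c}

/-- The normal coordinate is affine. [folklore] -/
theorem nco_convex_comb (w₀ n z z' : ℂ) {a b : ℝ} (hab : a + b = 1) :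
    nco w₀ n (a • z + b • z') = a * nco w₀ n z + b * nco w₀ n z' := by
  have hab' : (a : ℂ) + (b : ℂ) = 1 := by exact_mod_cast hab
  have h : a • z + b • z' - w₀ = (a : ℂ) * (z - w₀) + (b : ℂ) * (z' - w₀) := by
    rw [Complex.real_smul, Complex.real_smul]; linear_combination w₀ * hab'
  simp only [nco, h, add_mul, mul_assoc, Complex.add_re, Complex.re_ofReal_mul]

/-- The collar is convex. [folklore] -/
theorem convex_collar (w₀ n : ℂ) (a b c : ℝ) : Convex ℝ (collar w₀ n a b c) := by
  intro z hz z' hz' s t hs ht hst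
  obtain rfl : t = 1 - s := by linarith
  obtain ⟨h1, h2, h3⟩ := hz
  obtain ⟨h1', h2', h3'⟩ := hz'
  rw [abs_le] at h1 h1'
  have k1 := mul_le_mul_of_nonneg_left h1.1 hs; have k2 := mul_le_mul_of_nonneg_left h1'.1 ht
  have k3 := mul_le_mul_of_nonneg_left h1.2 hs; have k4 := mul_le_mul_of_nonneg_left h1'.2 ht
  have k5 := mul_le_mul_of_nonneg_left h2 hs; have k6 := mul_le_mul_of_nonneg_left h2' ht
  have k7 := mul_le_mul_of_nonneg_left h3 hs; have k8 := mul_le_mul_of_nonneg_left h3' ht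
  refine ⟨?_, ?_, ?_⟩
  · rw [tco_eq_nco, nco_convex_comb _ _ _ _ hst, abs_le, ← tco_eq_nco, ← tco_eq_nco]; constructor <;> linarith
  · rw [nco_convex_comb _ _ _ _ hst]; linarith
  · rw [nco_convex_comb _ _ _ _ hst]; linarith

/-- The collar is compact. [folklore] -/
theorem isCompact_collar {n : ℂ} (hn : ‖n‖ = 1) (w₀ : ℂ) (a b c : ℝ) : IsCompact (collar w₀ n a b c) := by
  refine Metric.isCompact_of_isClosed_isBounded ?_ ((Metric.isBounded_closedBall (x := w₀) (r := a + |b| + |c|)).subset ?_)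
  · have hc1 : Continuous fun z : ℂ => tco w₀ n z := by unfold tco; fun_prop
    have hc2 : Continuous fun z : ℂ => nco w₀ n z := by unfold nco; fun_prop
    exact (isClosed_le (continuous_abs.comp hc1) continuous_const).inter
      ((isClosed_le continuous_const hc2).inter (isClosed_le hc2 continuous_const))
  · rintro z ⟨h1, h2, h3⟩
    rw [mem_closedBall, dist_eq_norm]
    have := norm_sub_le_nco_tco hn w₀ z
    have h4 : |nco w₀ n z| ≤ |b| + |c| := by
      rw [abs_le]; constructor <;> linarith [neg_abs_le b, le_abs_self c, neg_abs_le c, le_abs_self b]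
    linarith

/-- A collar of positive depth near the wall lies inside the domain. [folklore] -/
theorem collar_subset {D : DobrushinDomain} {w₀ n : ℂ} {r : ℝ} (hw : LocalHalfPlane D w₀ n r)
    {a b c : ℝ} (hb : 0 < b) (hac : a + c < 4 * r) : collar w₀ n a b c ⊆ D.carrier := by
  rintro z ⟨h1, h2, h3⟩
  have := norm_sub_le_nco_tco hw.1 w₀ z
  have h4 : |nco w₀ n z| ≤ c := by rw [abs_le]; constructor <;> linarith
  exact (mem_carrier_iff hw (by linarith)).2 (by linarith)

/-! ## Doubled lattice coordinates of medial vertices -/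

/-- Doubled abscissa of the medial vertex `s(x, x + eᵢ)`: `2x₀ + [i = 0]`. [folklore] -/
def U (p : Site 2 × Fin 2) : ℤ := 2 * p.1 0 + if p.2 = 0 then 1 else 0

/-- Doubled ordinate of the medial vertex `s(x, x + eᵢ)`: `2x₁ + [i = 1]`. [folklore] -/
def V (p : Site 2 × Fin 2) : ℤ := 2 * p.1 1 + if p.2 = 1 then 1 else 0

/-- The medial point in doubled coordinates (real part). [folklore] -/
theorem medialPoint_re (δ : ℝ) (p : Site 2 × Fin 2) : (medialPoint δ (medialVertexOf p)).re = δ / 2 * U p := by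
  obtain ⟨x, i⟩ := p
  fin_cases i <;> simp [medialVertexOf, U, meshPoint_re, Complex.add_re] <;> ring

/-- The medial point in doubled coordinates (imaginary part). [folklore] -/
theorem medialPoint_im (δ : ℝ) (p : Site 2 × Fin 2) : (medialPoint δ (medialVertexOf p)).im = δ / 2 * V p := by
  obtain ⟨x, i⟩ := p
  fin_cases i <;> simp [medialVertexOf, V, meshPoint_im, Complex.add_im] <;> ring

/-- The doubled coordinates determine the medial vertex. [folklore] -/
theorem eq_of_UV_eq {p q : Site 2 × Fin 2} (hU : U p = U q) (hV : V p = V q) : p = q := by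
  obtain ⟨x, i⟩ := p
  obtain ⟨y, j⟩ := q
  fin_cases i <;> fin_cases j <;> simp [U, V] at hU hV ⊢ <;>
    first | (funext l; fin_cases l <;> simp <;> omega) | omega

/-- The site of the twin is within sup-distance `1` of the site of the vertex. [folklore] -/
theorem abs_twin_sub_le (x : Site 2) (i : Fin 2) (k : Fin 4) (l : Fin 2) : |(twin x i k).1 l - x l| ≤ 1 := by
  fin_cases i <;> fin_cases k <;> fin_cases l <;> simp [twin]

/-- The lattice site of the `k`-th corner lies on the medial vertex (table `medialCornersAt_fst_eq_or`). [folklore] -/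
theorem corner_fst_mem (p : Site 2 × Fin 2) (k : Fin 4) : (medialCornersAt p.1 p.2 k).1 ∈ medialVertexOf p := by
  rcases medialCornersAt_fst_eq_or p.1 p.2 k with h | h <;> rw [h]
  exacts [Sym2.mem_mk_left _ _, Sym2.mem_mk_right _ _]

/-- An endpoint of the medial vertex is within `δ/2` of the medial point. [folklore] -/
theorem norm_endpoint_sub_medialPoint {δ : ℝ} (hδ : 0 ≤ δ) (x : Site 2) (i : Fin 2) {v : Site 2}
    (hv : v = x ∨ v = x + Pi.single i 1) : ‖meshPoint δ v - medialPoint δ (medialVertexOf (x, i))‖ ≤ δ / 2 := by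
  have hm : medialPoint δ (medialVertexOf (x, i)) = (meshPoint δ x + meshPoint δ (x + Pi.single i 1)) / 2 := rfl
  have h1 : ‖(meshPoint δ x - meshPoint δ (x + Pi.single i 1)) / 2‖ ≤ δ / 2 := by
    rw [norm_div, Complex.norm_ofNat]
    have : ‖meshPoint δ x - meshPoint δ (x + Pi.single i 1)‖ ≤ δ :=
      (norm_meshPoint_sub_le hδ _ _).trans (by fin_cases i <;> simp)
    linarith
  rcases hv with h | h
  · rwa [hm, h, show meshPoint δ x - (meshPoint δ x + meshPoint δ (x + Pi.single i 1)) / 2 =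
      (meshPoint δ x - meshPoint δ (x + Pi.single i 1)) / 2 by ring]
  · rwa [hm, h, show meshPoint δ (x + Pi.single i 1) - (meshPoint δ x + meshPoint δ (x + Pi.single i 1)) / 2 =
      -((meshPoint δ x - meshPoint δ (x + Pi.single i 1)) / 2) by ring, norm_neg]

/-- The site of the vertex is within `δ/2` of the medial point. [folklore] -/
theorem norm_meshPoint_fst_sub_medialPoint {δ : ℝ} (hδ : 0 ≤ δ) (p : Site 2 × Fin 2) :
    ‖meshPoint δ p.1 - medialPoint δ (medialVertexOf p)‖ ≤ δ / 2 :=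
  norm_endpoint_sub_medialPoint hδ p.1 p.2 (Or.inl rfl)

/-- The corner site is within `δ/2` of the medial point. [folklore] -/
theorem norm_corner_sub_medialPoint {δ : ℝ} (hδ : 0 ≤ δ) (p : Site 2 × Fin 2) (k : Fin 4) :
    ‖meshPoint δ (medialCornersAt p.1 p.2 k).1 - medialPoint δ (medialVertexOf p)‖ ≤ δ / 2 :=
  norm_endpoint_sub_medialPoint hδ p.1 p.2 (medialCornersAt_fst_eq_or p.1 p.2 k)

/-! ## Interior medial vertices from a full neighbourhood -/

/-- Lattice neighbours of the discrete domain with mesh points in a convex `K ⊆ Ω` are `Ω_δ`-adjacent. [folklore] -/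
theorem adj_of_mem {E : DiscreteDobrushin} {K : Set ℂ} (hK : Convex ℝ K) (hKΩ : K ⊆ E.Ω) {u w : Site 2}
    (hu : u ∈ meshDomain E.Ω E.δ) (huK : meshPoint E.δ u ∈ K) (hw : w ∈ meshDomain E.Ω E.δ)
    (hwK : meshPoint E.δ w ∈ K) (hadj : (zdGraph 2).Adj u w) : (discreteDomainGraph E.Ω E.δ).Adj u w :=
  discreteDomainGraph_adj_iff.2
    ⟨meshGraph_adj_iff.2 ⟨hadj, (hK.segment_subset huK hwK).trans (hKΩ.trans subset_closure)⟩, hu, hw⟩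

/-- A face whose corners have good neighbourhoods is an inner face. [folklore] -/
theorem isInnerFace_of_nbhd {E : DiscreteDobrushin} {K : Set ℂ} (hK : Convex ℝ K) (hKΩ : K ⊆ E.Ω)
    {x f : Site 2} (hxf : IsCorner x f)
    (h : ∀ u : Site 2, (∀ l, |u l - x l| ≤ 1) → u ∈ meshDomain E.Ω E.δ ∧ meshPoint E.δ u ∈ K) :
    E.IsInnerFace f := by
  -- corners of `f` are within sup-distance `1` of the corner `x`
  have hc : ∀ v : Site 2, IsCorner v f → ∀ l, |v l - x l| ≤ 1 := fun v hv l => by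
    rcases hv l with h | h <;> rcases hxf l with h' | h' <;> rw [h, h', abs_le] <;> constructor <;> linarith
  exact fun v w hv hw hadj => adj_of_mem hK hKΩ (h v (hc v hv)).1 (h v (hc v hv)).2 (h w (hc w hw)).1 (h w (hc w hw)).2 hadj

/-- A site with a good `1`-neighbourhood is not a boundary site. [folklore] -/
theorem not_mem_zdBoundary_of_nbhd {E : DiscreteDobrushin} {K : Set ℂ} (hK : Convex ℝ K) (hKΩ : K ⊆ E.Ω)
    {x : Site 2} (h : ∀ u : Site 2, (∀ l, |u l - x l| ≤ 1) → u ∈ meshDomain E.Ω E.δ ∧ meshPoint E.δ u ∈ K) :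
    x ∉ E.zdBoundary := by
  have hx := h x (fun l => by simp)
  rw [DiscreteDobrushin.mem_zdBoundary_iff]
  rintro (⟨-, y, hy, hny⟩ | ⟨y, -, -, f, hf, hxf, -⟩)
  · have hy' := h y fun l => by
      obtain ⟨i, hi | hi⟩ := (zdGraph_adj_iff x y).1 hy <;> subst hi <;> fin_cases i <;> fin_cases l <;> simp
    exact hny (adj_of_mem hK hKΩ hx.1 hx.2 hy'.1 hy'.2 hy)
  · exact hf (isInnerFace_of_nbhd hK hKΩ hxf h)

/-- **Interior from a full neighbourhood.** If every site within sup-distance `2` of `y` is a site of `Ω_δ` with mesh point in a convex `K ⊆ Ω`, the medial vertex `s(y, y + e_j)` is interior. [folklore] -/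
theorem interior_of_nbhd {E : DiscreteDobrushin} {K : Set ℂ} (hK : Convex ℝ K) (hKΩ : K ⊆ E.Ω) (y : Site 2) (j : Fin 2)
    (h : ∀ u : Site 2, (∀ l, |u l - y l| ≤ 2) → u ∈ meshDomain E.Ω E.δ ∧ meshPoint E.δ u ∈ K) :
    IsInteriorMV E (y, j) := by
  have hadj0 : (zdGraph 2).Adj y (y + Pi.single j 1) := (zdGraph_adj_iff _ _).2 ⟨j, Or.inl rfl⟩
  have hball : ∀ x : Site 2, (∀ l, |x l - y l| ≤ 1) →
      ∀ u : Site 2, (∀ l, |u l - x l| ≤ 1) → u ∈ meshDomain E.Ω E.δ ∧ meshPoint E.δ u ∈ K := by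
    refine fun x hx u hu => h u fun l => ?_
    have h1 := hx l; have h2 := hu l
    rw [abs_le] at h1 h2 ⊢; constructor <;> linarith
  have hy0 : ∀ l, |y l - y l| ≤ 1 := fun l => by simp
  have hy1 : ∀ l, |(y + Pi.single j 1 : Site 2) l - y l| ≤ 1 := fun l => by fin_cases j <;> fin_cases l <;> simp
  refine ⟨?_, fun x hx => ?_, fun f hyf _ => isInnerFace_of_nbhd hK hKΩ hyf (hball y hy0)⟩
  · show s(y, y + Pi.single j 1) ∈ _
    rw [SimpleGraph.mem_edgeSet]
    exact adj_of_mem hK hKΩ (hball y hy0 y hy0).1 (hball y hy0 y hy0).2 (hball y hy0 _ hy1).1 (hball y hy0 _ hy1).2 hadj0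
  · have hx1 : ∀ l, |x l - y l| ≤ 1 := by
      rcases Sym2.mem_iff.1 hx with rfl | rfl
      exacts [hy0, hy1]
    have hnb := not_mem_zdBoundary_of_nbhd hK hKΩ (hball x hx1)
    exact ⟨fun hA => hnb (E.zdArcA_subset_zdBoundary hA), fun hB => hnb (E.zdArcB_subset_zdBoundary hB)⟩

/-! ## Depth of the corners of an interior medial vertex -/

/-- Every site within sup-distance `1` of `v` is a corner of one of the four faces at `v`. [folklore] -/
theorem exists_isCorner_faceAt (v u : Site 2) (hu : ∀ l, |u l - v l| ≤ 1) : ∃ j, IsCorner u (faceAt v j) := by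
  have h0 := hu 0; have h1 := hu 1
  rw [abs_le] at h0 h1
  by_cases a : u 0 < v 0 <;> by_cases b : u 1 < v 1
  · refine ⟨2, fun l => ?_⟩; fin_cases l <;> simp [faceAt, cornerOff] <;> omega
  · refine ⟨1, fun l => ?_⟩; fin_cases l <;> simp [faceAt, cornerOff] <;> omega
  · refine ⟨3, fun l => ?_⟩; fin_cases l <;> simp [faceAt, cornerOff] <;> omega
  · refine ⟨0, fun l => ?_⟩; fin_cases l <;> simp [faceAt, cornerOff] <;> omega

/-- **Corner sites are deep.** For admissible data and an interior medial vertex `p`, every site within sup-distance `1` of the site of any of its four corners has its mesh point in `Ω` (the corner site is off the discrete boundary, so the four faces around it are inner: `faces_dichotomy`). [folklore] -/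
theorem meshPoint_mem_of_near_corner {E : DiscreteDobrushin} (hE : E.IsZdAdmissible) {p : Site 2 × Fin 2}
    (hp : IsInteriorMV E p) (k : Fin 4) (u : Site 2) (hu : ∀ l, |u l - (medialCornersAt p.1 p.2 k).1 l| ≤ 1) :
    meshPoint E.δ u ∈ E.Ω := by
  obtain ⟨hvA, hvB⟩ := hp.2.1 _ (corner_fst_mem p k)
  have hvb : (medialCornersAt p.1 p.2 k).1 ∉ E.zdBoundary := fun h => (hE.zdBoundary_subset h).elim hvA hvB
  have hin : E.IsInnerFace (medialCornersAt p.1 p.2 k).2 :=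
    hp.2.2 _ (isCorner_edge_medialCornersAt p.1 p.2 k).1 (isCorner_edge_medialCornersAt p.1 p.2 k).2
  obtain ⟨j₀, hj₀⟩ := exists_faceAt_of_isCorner (isCorner_medialCornersAt p.1 p.2 k)
  have hall : ∀ j, E.IsInnerFace (faceAt (medialCornersAt p.1 p.2 k).1 j) := by
    rcases E.faces_dichotomy hvb with h | h
    exacts [h, absurd (hj₀ ▸ hin) (h j₀)]
  obtain ⟨j, hj⟩ := exists_isCorner_faceAt _ u hu
  exact meshPoint_mem_of_isCorner_of_isInnerFace hj (hall j)

/-- `|n₁| + |n₂| ≥ 1` for a unit vector `n`. [folklore] -/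
theorem one_le_abs_re_add_abs_im {n : ℂ} (hn : ‖n‖ = 1) : 1 ≤ |n.re| + |n.im| := by
  have h1 : |n.re| ≤ 1 := (Complex.abs_re_le_norm n).trans hn.le
  have h2 : |n.im| ≤ 1 := (Complex.abs_im_le_norm n).trans hn.le
  have h3 : n.re * n.re + n.im * n.im = 1 := by rw [← Complex.normSq_apply, Complex.normSq_eq_norm_sq, hn]; norm_num
  nlinarith [abs_nonneg n.re, abs_nonneg n.im, sq_abs n.re, sq_abs n.im]

/-- **Corner sites of interior vertices near the straight wall have normal coordinate `> δ`** (registered one-line form below): the diagonal neighbour of the corner site pointing most against `n` is still in `Ω`, i.e. in the half-plane. [folklore] -/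
theorem delta_lt_nco_corner {D : DobrushinDomain} {E : DiscreteDobrushin} {w₀ n : ℂ} {r : ℝ}
    (hw : LocalHalfPlane D w₀ n r) (hΩ : E.Ω = D.carrier) (hE : E.IsZdAdmissible) {p : Site 2 × Fin 2}
    (hp : IsInteriorMV E p) (k : Fin 4)
    (hball : ∀ u : Site 2, (∀ l, |u l - (medialCornersAt p.1 p.2 k).1 l| ≤ 1) → ‖meshPoint E.δ u - w₀‖ < 4 * r) :
    E.δ < nco w₀ n (meshPoint E.δ (medialCornersAt p.1 p.2 k).1) := by
  set v := (medialCornersAt p.1 p.2 k).1 with hvdef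
  -- the signs pointing against `n`
  set a : ℤ := if 0 ≤ n.re then -1 else 1 with hadef
  set b : ℤ := if 0 ≤ n.im then -1 else 1 with hbdef
  have ha : (a : ℝ) * n.re = -|n.re| := by
    rw [hadef]; split_ifs with h
    · rw [abs_of_nonneg h]; simp
    · rw [abs_of_neg (not_le.1 h)]; simp
  have hb : (b : ℝ) * n.im = -|n.im| := by
    rw [hbdef]; split_ifs with h
    · rw [abs_of_nonneg h]; simp
    · rw [abs_of_neg (not_le.1 h)]; simp
  set u : Site 2 := fun l => v l + (![a, b] : Fin 2 → ℤ) l with hudef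
  have hu : ∀ l, |u l - v l| ≤ 1 := fun l => by
    fin_cases l <;> simp only [hudef, hadef, hbdef] <;> split_ifs <;> simp
  have hpos := (mem_carrier_iff hw (hball u hu)).1 (hΩ ▸ meshPoint_mem_of_near_corner hE hp k u hu)
  have hdiff := nco_meshPoint_sub w₀ n E.δ u v
  rw [show ((u 0 - v 0 : ℤ) : ℝ) = a by simp [hudef], show ((u 1 - v 1 : ℤ) : ℝ) = b by simp [hudef], ha, hb] at hdiff
  nlinarith [one_le_abs_re_add_abs_im hw.1, hE.delta_pos]

end S6

open Literature.Probability.LatticeModels in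
/-- **Registered one-line form `stub_flux_cornerDepth`** (sub-goal of stmt-CriticalPhenomena-10814 carried by this helper file): for admissible data discretising a Dobrushin domain with a straight piece of wall, every corner site of an interior medial vertex whose `1`-neighbourhood is seen by the half-plane window has normal coordinate `Re((δv - w₀)·n̄) > δ` — lattice depth at least one, where the uniform inner envelope applies. [folklore] -/
theorem stub_flux_cornerDepth : ∀ (D : DobrushinDomain) (E : DiscreteDobrushin) (w₀ n : ℂ) (r : ℝ), LocalHalfPlane D w₀ n r → E.Ω = D.carrier → E.IsZdAdmissible → ∀ (p : Site 2 × Fin 2) (k : Fin 4), IsInteriorMV E p → (∀ u : Site 2, (∀ l, |u l - (Literature.Barriers.CriticalPhenomena.medialCornersAt p.1 p.2 k).1 l| ≤ 1) → ‖meshPoint E.δ u - w₀‖ < 4 * r) → E.δ < ((meshPoint E.δ (Literature.Barriers.CriticalPhenomena.medialCornersAt p.1 p.2 k).1 - w₀) * (starRingEnd ℂ) n).re :=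
  fun _ _ _ _ _ hw hΩ hE _ k hp hball => S6.delta_lt_nco_corner hw hΩ hE hp k hball

end Summit.CriticalPhenomena.CardyFormulaZ2.Theorems.ParafermionFamiliesToSLESix.StripAnchored

end
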